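import Summits.QuantumFields.YangMills.Theorems.UnitScaleTiltProp7CovariantOffKernel
import Summits.QuantumFields.YangMills.Theorems.UnitScaleTiltProp7CovLineAvgTaylor
import Summits.QuantumFields.YangMills.Theorems.UnitScaleTiltProp7LineAvgRightInverse
import HarnessLib

/-!
# Route `UnitScaleTilt`, crux K1 child «MinimiserStabilityRegPr» (stmt-QuantumFields-19200), registered stub `stub_prop7From14` (leaf V3 «Prop 7 from a
# background (14)») — [B9] THM 3.11 IN `L²` FORM ON THE (MODEL) AVERAGING FIBRE FOR SECANTS: the averaging penalty of the off-kernel engine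
# (p483802) IS AFFORDABLE — `L^{−2(K−n)}Σ‖Y‖² ≤ 36(Σ‖D_{U₀}Y‖²_HS + Σ‖D^*_{U₀}Y‖²_HS)` whenever `U = (1+Y)U₀` has the same comb-transported straight-contour
# block averages as `U₀` and `8L^{K−n}·max‖Y‖ ≤ 1`

Cell `ym3-torus` ∕ fleet seat `ym-ust-19200-p1` (gen 4).  WHY.  In the `ℓ²` route to the uniqueness clause of [Balaban1985Variational] Prop. 7 (p504929) the
fluctuation `Y = UU₀⁻¹ − 1` between two points of ONE averaging fibre is a SECANT, not a tangent vector: the linearised average `M_{U₀}Y` does not vanish, it is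
minus the second-order remainder of the averaging map.  The item's engine off the kernel (`Prop7CovariantCoercivity.sum_normSq_le_curl_sq_add_divB_sq_add_avg_T3`,
p483802) keeps the penalty `16·L^{(K−n)(d−2)}·Σ_c‖(M_{U₀}Y)(c)‖²` (in difference units); the covariant Taylor bound in `ℓ²`-along-contours form
(`Prop7CovLineAvgTaylor.norm_avg_lineRatio_sub_smul_covLineAvg_le`, p519482) makes it `≤ 32·max‖Y‖²·Σ‖Y‖²`, i.e. `≤ ½·L^{−2(K−n)}Σ‖Y‖²` as soon as
`8L^{K−n}max‖Y‖ ≤ 1` — the chart scale of [Balaban1985Variational] (19) (`|A| ≤ ε₂`, `Y ≈ ηA`, `η = L^{−(K−n)}`).  This file performs that composition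
for the MODEL constraint «the block averages of the comb-transported ratios `U(line)U₀(line)⁻¹` are `1`» (straight contours, no `exp`-mean-`log`); for the
(0.4) average of record the same composition needs the `ℓ²`-along-contours remainder of `BlockAveraging.avgFun` (CARD-19200-V3-g4 §Open, D1c (iii)).
So, for secants on the model fibre, Thm 3.11's `L²` form holds with constant `36` in place of the kernel constant `18` — the penalty costs a factor `2`, not a
power of `L^{K−n}` (the scaling claim of CARD-19200-V3-g4, kernel-checked).

WHAT IS PROVED HERE (sorry-free, no definition).
* `sum_sum_normSq_line_le` (tent count: `Σ_rΣ_{t<n}‖Y(x_r+te_μ)‖² ≤ n·(Σ_r‖Y(x_r)‖² + Σ_r‖Y(x′_r)‖²)` on the two blocks), `sum_pair_normSq_eq` (`Σ_c` of the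
  two-block masses `= 2Σ_b‖Y(b)‖²`), `norm_covLineSum_le_of_modelFibre` (`‖Σ_rΣ_t R(…)Y‖ ≤ L^{K−n}·Σ_rΣ_t‖Y‖²` on the model fibre),
  **`sum_normSq_le_curl_sq_add_divB_sq_of_modelFibre_T3`** (the title).

HONEST SCOPE.  Model constraint (straight contours with comb transport to the block base point, as in p483802's averaging term), full covariant divergence
`D^*_{U₀}` (print's `RD^*` slice needs the R-engine, open), d = 3 carrier, `SU(2)`.  Nothing of Bałaban's is asserted.

References: T. Bałaban, CMP 102 (1985) 277–309 [Balaban1985Variational] ((19) p.281, (44) p.285); [Balaban1985BackgroundPropagators] Thm 3.11 p.416.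
-/

noncomputable section

open scoped BigOperators Matrix.Norms.L2Operator Matrix

namespace Summit.QuantumFields.YangMills.Theorems.Prop7CovLineAvgTaylor

open Literature.MathematicalPhysics.QuantumFieldTheory.Balaban1983to89
open Finset B1RG242Torus LatticeFieldCalculus
open B7Prop1Explicit (plaqWord U1 treeWord)
open B7Eq78Linearization (conjR)
open B9Eq39Adjoint (curl divB)
open B10StarCount (sum_pbond)
open B10Eq27TorusAxialLog (holT unitsField toUField)
open B9TorusCalculus (torusT)
open Summit.QuantumFields.YangMills.Theorems.Prop7FlatCoercivity (iterate_shift_eq_runSite sum_fibre_eq_sum_offsets)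
open Summit.QuantumFields.YangMills.Theorems.Prop7CovariantCoercivity (holT_mem hyp_of_specialUnitary sum_normSq_le_curl_sq_add_divB_sq_add_avg_T3)
open Summit.QuantumFields.YangMills.Theorems.Prop7LineAvgRightInverse (sum_offsets_sum_range_runSite unshift_runSite_one sum_pbond_fine_eq sum_dir_site_eq
  sum_pbond_runSite_one)

variable {P : Params} {k : ℕ}

/-! ## §1 Two-block masses -/

/-- **TENT COUNT OF THE `ℓ²` MASS ALONG THE CONTOURS OF A BLOCK**: `Σ_rΣ_{t<L^k}‖Y(x_r+te_μ)‖² ≤ L^k·(Σ_r‖Y(x_r)‖² + Σ_r‖Y(x′_r)‖²)`, `x_r`/`x′_r` the sites of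
offset `r` of the block and of the next block along `μ` (each bond is visited at most `L^k` times). [folklore] -/
theorem sum_sum_normSq_line_le {𝔸 : Type*} [NormedRing 𝔸] (h : P.sitesPerDir 0 = P.L ^ k * P.sitesPerDir k) (Y : PBond P 0 → 𝔸) (y : Site P k) (μ : Fin P.d) :
    ∑ r : Fin P.d → Fin (P.L ^ k), ∑ t : Fin (P.L ^ k), ‖Y ⟨(fun z : Site P 0 => z.shift μ)^[(t : ℕ)] (Site.fibreSite 0 k y r), μ⟩‖ ^ 2
      ≤ (P.L : ℝ) ^ k * (∑ r : Fin P.d → Fin (P.L ^ k), ‖Y ⟨Site.fibreSite 0 k y r, μ⟩‖ ^ 2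
          + ∑ r : Fin P.d → Fin (P.L ^ k), ‖Y ⟨Site.fibreSite 0 k (runSite y μ 1) r, μ⟩‖ ^ 2) := by
  have hcount := sum_offsets_sum_range_runSite μ h y (fun z => ‖Y ⟨z, μ⟩‖ ^ 2)
  simp only [iterate_shift_eq_runSite]
  rw [show (∑ r : Fin P.d → Fin (P.L ^ k), ∑ t : Fin (P.L ^ k), ‖Y ⟨runSite (Site.fibreSite 0 k y r) μ (t : ℕ), μ⟩‖ ^ 2)
      = ∑ r : Fin P.d → Fin (P.L ^ k), ∑ t ∈ range (P.L ^ k), ‖Y ⟨runSite (Site.fibreSite 0 k y r) μ t, μ⟩‖ ^ 2 from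
      Finset.sum_congr rfl fun r _ => (Finset.sum_range (fun t => ‖Y ⟨runSite (Site.fibreSite 0 k y r) μ t, μ⟩‖ ^ 2)).symm, hcount]
  simp only [nsmul_eq_mul]
  rw [mul_add, Finset.mul_sum, Finset.mul_sum]
  have hN : ∀ r : Fin P.d → Fin (P.L ^ k), (((r μ : ℕ) + 1 : ℕ) : ℝ) ≤ (P.L : ℝ) ^ k := fun r => by
    have := (r μ).isLt
    have : (((r μ : ℕ) + 1 : ℕ) : ℝ) ≤ ((P.L ^ k : ℕ) : ℝ) := by exact_mod_cast this
    push_cast at this ⊢; exact this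
  have hN' : ∀ r : Fin P.d → Fin (P.L ^ k), ((P.L ^ k - 1 - (r μ : ℕ) : ℕ) : ℝ) ≤ (P.L : ℝ) ^ k := fun r => by
    have : ((P.L ^ k - 1 - (r μ : ℕ) : ℕ) : ℝ) ≤ ((P.L ^ k : ℕ) : ℝ) := by exact_mod_cast (by omega)
    push_cast at this; exact this
  refine add_le_add (Finset.sum_le_sum fun r _ => ?_) (Finset.sum_le_sum fun r _ => ?_)
  · push_cast
    exact mul_le_mul_of_nonneg_right (by have := hN r; push_cast at this; exact this) (sq_nonneg _)
  · exact mul_le_mul_of_nonneg_right (hN' r) (sq_nonneg _)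

/-- The two-block masses summed over the coarse bonds give twice the total mass: `Σ_c (Σ_r‖Y(x_r(c))‖² + Σ_r‖Y(x′_r(c))‖²) = 2Σ_b‖Y(b)‖²`. [folklore] -/
theorem sum_pair_normSq_eq {𝔸 : Type*} [NormedRing 𝔸] (h : P.sitesPerDir 0 = P.L ^ k * P.sitesPerDir k) (Y : PBond P 0 → 𝔸) :
    ∑ c : PBond P k, (∑ r : Fin P.d → Fin (P.L ^ k), ‖Y ⟨Site.fibreSite 0 k c.src r, c.dir⟩‖ ^ 2
        + ∑ r : Fin P.d → Fin (P.L ^ k), ‖Y ⟨Site.fibreSite 0 k (runSite c.src c.dir 1) r, c.dir⟩‖ ^ 2)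
      = 2 * ∑ b : PBond P 0, ‖Y b‖ ^ 2 := by
  rw [Finset.sum_add_distrib, sum_pbond_runSite_one (fun c : PBond P k => ∑ r : Fin P.d → Fin (P.L ^ k), ‖Y ⟨Site.fibreSite 0 k c.src r, c.dir⟩‖ ^ 2),
    ← sum_dir_site_eq (fun c : PBond P k => ∑ r : Fin P.d → Fin (P.L ^ k), ‖Y ⟨Site.fibreSite 0 k c.src r, c.dir⟩‖ ^ 2),
    ← sum_pbond_fine_eq h (fun b => ‖Y b‖ ^ 2)]
  ring

/-! ## §2 The averaging term on the model fibre -/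

variable {N : ℕ} [NeZero N]

/-- **ON THE MODEL FIBRE THE COVARIANT LINE SUMS ARE SECOND ORDER**: if `U = (1+Y)U₀` with `U₀` valued in `U1`, `‖Y‖ ≤ δ`, `L^kδ ≤ 1`, and the block sum of the
comb-transported contour ratios `R(u_r)(U(line_r)U₀(line_r)⁻¹ − 1)` vanishes, then `‖Σ_rΣ_{t<L^k}R(u_r·U₀([x_r,x_r+te_μ]))Y(x_r+te_μ)‖ ≤ L^k·Σ_rΣ_t‖Y(x_r+te_μ)‖²`.
[cite: Balaban1985Averaging, Prop. 3 (122)-(125) p.36] -/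
theorem norm_covLineSum_le_of_modelFibre {V V₀ : GaugeField P 0 (Matrix (Fin N) (Fin N) ℂ)ˣ} {Y : PBond P 0 → Matrix (Fin N) (Fin N) ℂ}
    (hY : ∀ b : PBond P 0, (V b : Matrix (Fin N) (Fin N) ℂ) = (1 + Y b) * (V₀ b : Matrix (Fin N) (Fin N) ℂ))
    (hV₀ : ∀ b : PBond P 0, V₀ b ∈ U1 (Matrix (Fin N) (Fin N) ℂ)) {δ : ℝ} (hYδ : ∀ b : PBond P 0, ‖Y b‖ ≤ δ) (hδ : (P.L : ℝ) ^ k * δ ≤ 1)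
    (μ : Fin P.d) (u : (Fin P.d → Fin (P.L ^ k)) → (Matrix (Fin N) (Fin N) ℂ)ˣ) (hu : ∀ r, u r ∈ U1 (Matrix (Fin N) (Fin N) ℂ))
    (xr : (Fin P.d → Fin (P.L ^ k)) → Site P 0)
    (hfib : ∑ r : Fin P.d → Fin (P.L ^ k), conjR (u r)
        (((holT V (xr r) (List.replicate (P.L ^ k) (μ, true)) : (Matrix (Fin N) (Fin N) ℂ)ˣ) : Matrix (Fin N) (Fin N) ℂ)
          * (((holT V₀ (xr r) (List.replicate (P.L ^ k) (μ, true)))⁻¹ : (Matrix (Fin N) (Fin N) ℂ)ˣ) : Matrix (Fin N) (Fin N) ℂ) - 1) = 0) :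
    ‖∑ r : Fin P.d → Fin (P.L ^ k), ∑ t : Fin (P.L ^ k),
        conjR (u r * holT V₀ (xr r) (List.replicate (t : ℕ) (μ, true))) (Y ⟨(fun z : Site P 0 => z.shift μ)^[(t : ℕ)] (xr r), μ⟩)‖
      ≤ (P.L : ℝ) ^ k * ∑ r : Fin P.d → Fin (P.L ^ k), ∑ t : Fin (P.L ^ k), ‖Y ⟨(fun z : Site P 0 => z.shift μ)^[(t : ℕ)] (xr r), μ⟩‖ ^ 2 := by
  have hN0 : (0 : ℝ) < (P.L : ℝ) ^ k := pow_pos (by exact_mod_cast P.L_pos) k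
  have hd : 1 ≤ P.d := P.hd
  have h := norm_avg_lineRatio_sub_smul_covLineAvg_le hY hV₀ hYδ hδ μ u hu xr
  rw [hfib, smul_zero, zero_sub, norm_neg, norm_smul, norm_inv, norm_pow, norm_pow, Real.norm_natCast] at h
  -- multiply through by `L^{kd}`
  have hpow : ((P.L : ℝ) ^ k) ^ P.d * (((P.L : ℝ) ^ k) ^ (P.d - 1))⁻¹ = (P.L : ℝ) ^ k := by
    have : ((P.L : ℝ) ^ k) ^ P.d = ((P.L : ℝ) ^ k) ^ (P.d - 1) * (P.L : ℝ) ^ k := by rw [← pow_succ]; congr 1; omega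
    rw [this]; field_simp
  have hpos : (0 : ℝ) < ((P.L : ℝ) ^ k) ^ P.d := by positivity
  have h2 := mul_le_mul_of_nonneg_left h hpos.le
  rw [← mul_assoc, mul_inv_cancel₀ hpos.ne', one_mul, ← mul_assoc, hpow] at h2
  exact h2

/-! ## §3 [B9] Thm 3.11 in `L²` form for secants on the model fibre, d = 3 carrier -/

/-- **[B9] THM 3.11 IN `L²` FORM FOR SECANTS ON THE MODEL AVERAGING FIBRE, d = 3 CARRIER**: for an `SU(2)` background `U₀` with
`dist1(U₀(∂p)) ≤ εL^{−2(K−n)}`, `216ε ≤ 1`, a units field `U = (1+Y)U₀` with `‖Y‖ ≤ δ`, `8L^{K−n}δ ≤ 1`, whose comb-transported straight-contour ratios have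
vanishing block sums (the model averaging constraint, for every coarse bond), `L^{−2(K−n)}Σ_b‖Y(b)‖² ≤ 36·(Σ‖D_{U₀}Y‖²_HS + Σ‖D^*_{U₀}Y‖²_HS)` — the averaging
penalty of the off-kernel engine (p483802) absorbed at the cost of a factor `2`. [cite: Balaban1985BackgroundPropagators, Thm 3.11 p.416] -/
theorem sum_normSq_le_curl_sq_add_divB_sq_of_modelFibre_T3 (F : T3ContinuumYM3Torus.T3Family) (n K : ℕ)
    (U₀ : GaugeField (F.P K) 0 (Matrix.specialUnitaryGroup (Fin 2) ℂ)) {ε : ℝ} (hε : 0 ≤ ε) (hε1 : 216 * ε ≤ 1)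
    (hU : ∀ p : Plaq (F.P K) 0, dist1 (GaugeField.plaqHol U₀ p) ≤ ε * (((F.L : ℝ) ^ (K - n)) ^ 2)⁻¹)
    (V : GaugeField (F.P K) 0 (Matrix (Fin 2) (Fin 2) ℂ)ˣ) (Y : PBond (F.P K) 0 → Matrix (Fin 2) (Fin 2) ℂ)
    (hY : ∀ b : PBond (F.P K) 0, (V b : Matrix (Fin 2) (Fin 2) ℂ) = (1 + Y b) * (unitsField (toUField U₀) b : Matrix (Fin 2) (Fin 2) ℂ))
    {δ : ℝ} (hYδ : ∀ b : PBond (F.P K) 0, ‖Y b‖ ≤ δ) (hδ : 8 * (F.L : ℝ) ^ (K - n) * δ ≤ 1)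
    (hfib : ∀ c : PBond (F.P K) (K - n), ∑ r : Fin (F.P K).d → Fin ((F.P K).L ^ (K - n)),
      conjR (holT (unitsField (toUField U₀)) (Site.fibreSite 0 (K - n) c.src fun _ => ⟨0, pow_pos (F.P K).L_pos (K - n)⟩)
              (treeWord fun ν => ((r ν : ℕ) : ℤ)))
        (((holT V (Site.fibreSite 0 (K - n) c.src r) (List.replicate ((F.P K).L ^ (K - n)) (c.dir, true)) : (Matrix (Fin 2) (Fin 2) ℂ)ˣ) : Matrix (Fin 2) (Fin 2) ℂ)
          * (((holT (unitsField (toUField U₀)) (Site.fibreSite 0 (K - n) c.src r) (List.replicate ((F.P K).L ^ (K - n)) (c.dir, true)))⁻¹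
              : (Matrix (Fin 2) (Fin 2) ℂ)ˣ) : Matrix (Fin 2) (Fin 2) ℂ) - 1) = 0) :
    (((F.L : ℝ) ^ (K - n)) ^ 2)⁻¹ * ∑ b : PBond (F.P K) 0, ‖Y b‖ ^ 2
      ≤ 36 * (∑ x : Site (F.P K) 0, ∑ μ : Fin (F.P K).d, ∑ ν : Fin (F.P K).d,
            (if μ < ν then ∑ j : Fin 2, ∑ k : Fin 2,
              ‖(curl (torusT (F.P K) 0) (fun κ z => unitsField (toUField U₀) ⟨z, κ⟩) (fun κ z => Y ⟨z, κ⟩) μ ν x) j k‖ ^ 2 else 0)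
          + ∑ x : Site (F.P K) 0, ∑ j : Fin 2, ∑ k : Fin 2,
              ‖(divB (torusT (F.P K) 0) (fun κ z => unitsField (toUField U₀) ⟨z, κ⟩) (fun κ z => Y ⟨z, κ⟩) x) j k‖ ^ 2) := by
  obtain ⟨hV₀, -⟩ := hyp_of_specialUnitary U₀ hU
  have hsites := Prop7FlatCoercivity.sitesPerDir_T3 F n K
  have hLF : ((F.P K).L : ℝ) = (F.L : ℝ) := by norm_cast
  have hd : (F.P K).d = 3 := rfl
  set nR : ℝ := (F.L : ℝ) ^ (K - n) with hnR
  have hn0 : (0 : ℝ) < nR := by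
    have : (0 : ℝ) < F.L := by have := F.hL.2; exact_mod_cast (by omega : 0 < F.L)
    positivity
  have hδ0 : 0 ≤ δ := (norm_nonneg _).trans (hYδ ⟨fun _ => 0, ⟨0, (F.P K).hd⟩⟩)
  have hnδ : ((F.P K).L : ℝ) ^ (K - n) * δ ≤ 1 := by rw [hLF]; nlinarith
  -- the engine off the kernel
  have hE := sum_normSq_le_curl_sq_add_divB_sq_add_avg_T3 F n K U₀ hε hε1 hU Y
  -- the averaging term, coarse bond by coarse bond
  set S : ℝ := ∑ b : PBond (F.P K) 0, ‖Y b‖ ^ 2 with hS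
  have hS0 : 0 ≤ S := Finset.sum_nonneg fun _ _ => sq_nonneg _
  have hA : ∀ c : PBond (F.P K) (K - n),
      ‖∑ r : Fin (F.P K).d → Fin ((F.P K).L ^ (K - n)), ∑ t ∈ range ((F.P K).L ^ (K - n)),
        conjR (holT (unitsField (toUField U₀)) (Site.fibreSite 0 (K - n) c.src fun _ => ⟨0, pow_pos (F.P K).L_pos (K - n)⟩)
              (treeWord fun ν => ((r ν : ℕ) : ℤ))
            * holT (unitsField (toUField U₀)) (Site.fibreSite 0 (K - n) c.src r) (List.replicate t (c.dir, true)))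
          (Y ⟨(fun z : Site (F.P K) 0 => z.shift c.dir)^[t] (Site.fibreSite 0 (K - n) c.src r), c.dir⟩)‖ ^ 2
        ≤ nR ^ ((F.P K).d + 4) * δ ^ 2 * (∑ r : Fin (F.P K).d → Fin ((F.P K).L ^ (K - n)), ‖Y ⟨Site.fibreSite 0 (K - n) c.src r, c.dir⟩‖ ^ 2
            + ∑ r : Fin (F.P K).d → Fin ((F.P K).L ^ (K - n)), ‖Y ⟨Site.fibreSite 0 (K - n) (runSite c.src c.dir 1) r, c.dir⟩‖ ^ 2) := by
    intro c
    -- `Σ_{t ∈ range}` ↦ `Σ_{t : Fin}`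
    have hrg : (∑ r : Fin (F.P K).d → Fin ((F.P K).L ^ (K - n)), ∑ t ∈ range ((F.P K).L ^ (K - n)),
        conjR (holT (unitsField (toUField U₀)) (Site.fibreSite 0 (K - n) c.src fun _ => ⟨0, pow_pos (F.P K).L_pos (K - n)⟩)
              (treeWord fun ν => ((r ν : ℕ) : ℤ))
            * holT (unitsField (toUField U₀)) (Site.fibreSite 0 (K - n) c.src r) (List.replicate t (c.dir, true)))
          (Y ⟨(fun z : Site (F.P K) 0 => z.shift c.dir)^[t] (Site.fibreSite 0 (K - n) c.src r), c.dir⟩))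
        = ∑ r : Fin (F.P K).d → Fin ((F.P K).L ^ (K - n)), ∑ t : Fin ((F.P K).L ^ (K - n)),
        conjR (holT (unitsField (toUField U₀)) (Site.fibreSite 0 (K - n) c.src fun _ => ⟨0, pow_pos (F.P K).L_pos (K - n)⟩)
              (treeWord fun ν => ((r ν : ℕ) : ℤ))
            * holT (unitsField (toUField U₀)) (Site.fibreSite 0 (K - n) c.src r) (List.replicate (t : ℕ) (c.dir, true)))
          (Y ⟨(fun z : Site (F.P K) 0 => z.shift c.dir)^[(t : ℕ)] (Site.fibreSite 0 (K - n) c.src r), c.dir⟩) :=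
      Finset.sum_congr rfl fun r _ => by simp only [Finset.sum_range]
    rw [hrg]
    set T : ℝ := ∑ r : Fin (F.P K).d → Fin ((F.P K).L ^ (K - n)), ∑ t : Fin ((F.P K).L ^ (K - n)),
        ‖Y ⟨(fun z : Site (F.P K) 0 => z.shift c.dir)^[(t : ℕ)] (Site.fibreSite 0 (K - n) c.src r), c.dir⟩‖ ^ 2 with hT
    set Spair : ℝ := ∑ r : Fin (F.P K).d → Fin ((F.P K).L ^ (K - n)), ‖Y ⟨Site.fibreSite 0 (K - n) c.src r, c.dir⟩‖ ^ 2
        + ∑ r : Fin (F.P K).d → Fin ((F.P K).L ^ (K - n)), ‖Y ⟨Site.fibreSite 0 (K - n) (runSite c.src c.dir 1) r, c.dir⟩‖ ^ 2 with hSpair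
    have hT0 : 0 ≤ T := Finset.sum_nonneg fun _ _ => Finset.sum_nonneg fun _ _ => sq_nonneg _
    -- (i) the norm of the line sum on the model fibre
    have h1 := norm_covLineSum_le_of_modelFibre (P := F.P K) (k := K - n) hY hV₀ hYδ hnδ c.dir
      (fun r => holT (unitsField (toUField U₀)) (Site.fibreSite 0 (K - n) c.src fun _ => ⟨0, pow_pos (F.P K).L_pos (K - n)⟩) (treeWord fun ν => ((r ν : ℕ) : ℤ)))
      (fun r => holT_mem hV₀ _ _) (fun r => Site.fibreSite 0 (K - n) c.src r) (hfib c)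
    rw [hLF] at h1
    -- (ii) tent count and the sup bound
    have h2 : T ≤ nR * Spair := by
      have := sum_sum_normSq_line_le (P := F.P K) (k := K - n) hsites Y c.src c.dir
      rw [hLF] at this; exact this
    have h3 : T ≤ nR ^ ((F.P K).d + 1) * δ ^ 2 := by
      calc T ≤ ∑ _r : Fin (F.P K).d → Fin ((F.P K).L ^ (K - n)), ∑ _t : Fin ((F.P K).L ^ (K - n)), δ ^ 2 :=
            Finset.sum_le_sum fun r _ => Finset.sum_le_sum fun t _ => pow_le_pow_left₀ (norm_nonneg _) (hYδ _) 2
        _ = nR ^ ((F.P K).d + 1) * δ ^ 2 := by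
            rw [Finset.sum_const, Finset.sum_const, Finset.card_univ, Finset.card_univ, Fintype.card_fun, Fintype.card_fin, Fintype.card_fin,
              smul_smul, nsmul_eq_mul]
            push_cast; rw [hLF, hnR]; ring
    -- (iii) combine: `‖Σ‖² ≤ (nT)² ≤ n²·T·(n^{d+1}δ²)... ≤ n^{d+4}δ²·Spair`
    have hsq : ‖_‖ ^ 2 ≤ (nR * T) ^ 2 := pow_le_pow_left₀ (norm_nonneg _) h1 2
    calc _ ≤ (nR * T) ^ 2 := hsq
      _ = nR ^ 2 * T * T := by ring
      _ ≤ nR ^ 2 * (nR ^ ((F.P K).d + 1) * δ ^ 2) * (nR * Spair) := by gcongr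
      _ = nR ^ ((F.P K).d + 4) * δ ^ 2 * Spair := by ring
  -- sum over the coarse bonds
  have hAsum : ∑ c : PBond (F.P K) (K - n),
      ‖∑ r : Fin (F.P K).d → Fin ((F.P K).L ^ (K - n)), ∑ t ∈ range ((F.P K).L ^ (K - n)),
        conjR (holT (unitsField (toUField U₀)) (Site.fibreSite 0 (K - n) c.src fun _ => ⟨0, pow_pos (F.P K).L_pos (K - n)⟩)
              (treeWord fun ν => ((r ν : ℕ) : ℤ))
            * holT (unitsField (toUField U₀)) (Site.fibreSite 0 (K - n) c.src r) (List.replicate t (c.dir, true)))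
          (Y ⟨(fun z : Site (F.P K) 0 => z.shift c.dir)^[t] (Site.fibreSite 0 (K - n) c.src r), c.dir⟩)‖ ^ 2
        ≤ nR ^ ((F.P K).d + 4) * δ ^ 2 * (2 * S) := by
    refine (Finset.sum_le_sum fun c _ => hA c).trans ?_
    rw [← Finset.mul_sum, sum_pair_normSq_eq (P := F.P K) (k := K - n) hsites Y]
  -- the penalty is `≤ 32δ²S ≤ ½ n⁻² S`
  have hcoef : 16 * ((nR ^ (F.P K).d * nR ^ 2)⁻¹ * (nR ^ 2)⁻¹)
      * (nR ^ ((F.P K).d + 4) * δ ^ 2 * (2 * S)) = 32 * δ ^ 2 * S := by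
    field_simp; ring
  have hpen : 16 * ((nR ^ (F.P K).d * nR ^ 2)⁻¹ * (nR ^ 2)⁻¹)
      * ∑ c : PBond (F.P K) (K - n),
      ‖∑ r : Fin (F.P K).d → Fin ((F.P K).L ^ (K - n)), ∑ t ∈ range ((F.P K).L ^ (K - n)),
        conjR (holT (unitsField (toUField U₀)) (Site.fibreSite 0 (K - n) c.src fun _ => ⟨0, pow_pos (F.P K).L_pos (K - n)⟩)
              (treeWord fun ν => ((r ν : ℕ) : ℤ))
            * holT (unitsField (toUField U₀)) (Site.fibreSite 0 (K - n) c.src r) (List.replicate t (c.dir, true)))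
          (Y ⟨(fun z : Site (F.P K) 0 => z.shift c.dir)^[t] (Site.fibreSite 0 (K - n) c.src r), c.dir⟩)‖ ^ 2
        ≤ 32 * δ ^ 2 * S := by
    rw [← hcoef]
    exact mul_le_mul_of_nonneg_left hAsum (by positivity)
  have h32 : 32 * δ ^ 2 * S ≤ (1 / 2) * ((nR ^ 2)⁻¹ * S) := by
    -- `64 n² δ² ≤ 1`
    have h64 : 64 * (nR ^ 2 * δ ^ 2) ≤ 1 := by nlinarith [hδ, mul_nonneg hn0.le hδ0]
    have : 32 * δ ^ 2 ≤ (1 / 2) * (nR ^ 2)⁻¹ := by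
      rw [show (1 / 2 : ℝ) * (nR ^ 2)⁻¹ = 1 / (2 * nR ^ 2) by field_simp, le_div_iff₀ (by positivity)]
      nlinarith
    nlinarith
  linarith [hE, hpen, h32]

end Summit.QuantumFields.YangMills.Theorems.Prop7CovLineAvgTaylor

end
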